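import Mathlib
import Literature.AlgebraicGeometry.Resolution.NearPointHyperplane
import Literature.AlgebraicGeometry.Resolution.PointChartPresentation
import Literature.AlgebraicGeometry.Resolution.PowerSeriesRegularLocal
import HarnessLib

/-!
# Cutkosky 2009, proof of Thm. 10.18: a point step of a `τ = 1` sequence, read in good parameters, is a Tr1 or a Tr2 chart (PROVED)

Topic: `Literature/AlgebraicGeometry/Resolution`.  S. D. Cutkosky, *Resolution of singularities for
3-folds in positive characteristic*, Amer. J. Math. **131** (2009) 59–127 [cite: Cutkosky2009],
proof of Theorem 10.18, p. 37 l. 13–17 ("Now suppose that `Sing_r(I_n) = V(x_n, y_n, z_n)`. Then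
… `R_{n+1}` must be a Tr1 or Tr2 transformation of `R_n` by Lemma 5.1, since `V(z_n)` is an
approximate manifold of `I_n`"), Def. 10.10 (Tr1: `x = x₁, y = x₁(y₁ + η), z = x₁ z₁`; Tr2:
`x = x₁ y₁, y = y₁, z = y₁ z₁`; p. 31 l. 36–48).

This file puts together, in the frame of the `τ = 1` sequences of `CutkoskySurfaceOmegaSequence.lean`
(`k⟦x, y, z⟧`, steps `IsPointStep I I' φ r` = SOME presentation `u ↦ (u'_0, u'_0 u'_1, u'_0 u'_2)` of a
`k`-algebra map with weak transform `I' = (I R' : u'_0^r)`):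

* `NearPointHyperplane.lean` (Lemma 5.1 (2): the centre of the chart lies on the strict transform of
  the approximate hyperplane `V(z)`, `z ∈ (u 1, u 2) + 𝔪²`), and
* `PointChartPresentation.lean` (change of presentation to Tr1 / Tr2 with the same exceptional ideal),

after supplying the two standing facts about such steps: a `k`-algebra endomorphism of `k⟦x, y, z⟧`
presented by regular systems is a LOCAL homomorphism, and it induces a SURJECTION (indeed the identity
of `k`) on residue fields.

## What is PROVED (theorems only; no definition, no fact)

* `mem_maximalIdeal_iff_constantCoeff`, `sub_C_constantCoeff_mem_maximalIdeal` — the maximal ideal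
  of `k⟦x, y, z⟧`;
* `residueField_map_surjective` — for a `k`-algebra endomorphism that is a local homomorphism;
* `isLocalHom_of_isPointStepData` — locality of a presented point chart;
* `exists_goodChart_of_isPointStep` — **the Tr1 / Tr2 alternative for a point step in good
  parameters**: given `IsPointStep I I' φ r` (`r ≥ 1`), `I`, `I'` of order exactly `r`, regular
  parameters `c = (z, x, y)` with `I ⊆ (z^r) + 𝔪^{r+1}` (`V(z)` an approximate manifold), EITHER there
  are `η` (zero or a unit) and regular parameters `c' = (z₁, x₁, y₁)` of the target with `x₁ = φ(x)`,
  `φ(z) = x₁ z₁`, `φ(y − η x) = x₁ y₁`, `I R' ⊆ (x₁^r)`, `I' = (I R' : x₁^r)` (Tr1), OR regular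
  parameters with `y₁ = φ(y)`, `φ(z) = y₁ z₁`, `φ(x) = y₁ x₁`, `I R' ⊆ (y₁^r)`, `I' = (I R' : y₁^r)` (Tr2)
  — exactly the chart hypotheses `(h₁, h₀, h₂, hJ'def)` of the tree's `PolygonChartTransport` /
  `PointStepPrepared` / `ChartTwoStepPrepared` for the system `(z, x, y − η x)` resp. `(z, x, y)`.

AI-written; weaker than expert review.

## Sources

* S. D. Cutkosky, Amer. J. Math. 131 (2009), proof of Thm. 10.18 p. 36 l. 84 – p. 37 l. 50;
  Def. 10.10 p. 31 l. 36–48; Lemma 5.1 (2) p. 17 l. 46–50. [Cutkosky2009]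
-/

noncomputable section

open IsLocalRing

namespace Literature.AlgebraicGeometry.Resolution.Cutkosky2009

universe u

variable {k : Type u} [Field k]

/-! ## The maximal ideal and the residue field of `k⟦x, y, z⟧` -/

/-- `f ∈ 𝔪 ⟺ f(0) = 0` in `k⟦x, y, z⟧`. [cite: Cutkosky2009, §4 p. 14 l. 44–45] -/
theorem mem_maximalIdeal_iff_constantCoeff {f : MvPowerSeries (Fin 3) k} :
    f ∈ maximalIdeal (MvPowerSeries (Fin 3) k) ↔ MvPowerSeries.constantCoeff f = 0 := by
  rw [mem_maximalIdeal, mem_nonunits_iff, MvPowerSeries.isUnit_iff_constantCoeff, isUnit_iff_ne_zero,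
    not_not]

/-- `f − f(0) ∈ 𝔪`. [cite: Cutkosky2009, §4 p. 14 l. 44–45] -/
theorem sub_C_constantCoeff_mem_maximalIdeal (f : MvPowerSeries (Fin 3) k) :
    f - MvPowerSeries.C (MvPowerSeries.constantCoeff f) ∈ maximalIdeal (MvPowerSeries (Fin 3) k) := by
  rw [mem_maximalIdeal_iff_constantCoeff, map_sub, MvPowerSeries.constantCoeff_C, sub_self]

/-- A `k`-algebra endomorphism of `k⟦x, y, z⟧` which is a local homomorphism induces a surjection of
residue fields (both are `k`). [cite: Cutkosky2009, (11) p. 25 l. 20–40] -/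
theorem residueField_map_surjective (φ : MvPowerSeries (Fin 3) k →ₐ[k] MvPowerSeries (Fin 3) k)
    [IsLocalHom (φ : MvPowerSeries (Fin 3) k →+* MvPowerSeries (Fin 3) k)] :
    Function.Surjective
      (ResidueField.map (φ : MvPowerSeries (Fin 3) k →+* MvPowerSeries (Fin 3) k)) := by
  intro ρ
  obtain ⟨f, rfl⟩ := residue_surjective ρ
  refine ⟨residue _ (MvPowerSeries.C (MvPowerSeries.constantCoeff f)), ?_⟩
  rw [ResidueField.map_residue]
  have hC : (φ : MvPowerSeries (Fin 3) k →+* MvPowerSeries (Fin 3) k)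
      (MvPowerSeries.C (MvPowerSeries.constantCoeff f)) =
      MvPowerSeries.C (MvPowerSeries.constantCoeff f) := by
    show φ (algebraMap k (MvPowerSeries (Fin 3) k) (MvPowerSeries.constantCoeff f)) = _
    rw [AlgHom.commutes]; rfl
  rw [hC, eq_comm, ← sub_eq_zero, ← map_sub, residue_eq_zero_iff]
  exact sub_C_constantCoeff_mem_maximalIdeal f

/-- A `k`-algebra endomorphism of `k⟦x, y, z⟧` mapping a regular system of parameters into the
maximal ideal is a local homomorphism. [cite: Cutkosky2009, Def. 10.10 p. 31 l. 36–48] -/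
theorem isLocalHom_of_isPointStepData {φ : MvPowerSeries (Fin 3) k →ₐ[k] MvPowerSeries (Fin 3) k}
    {u : Fin 3 → MvPowerSeries (Fin 3) k} (hu : IsParams u)
    (hφu : ∀ i, φ (u i) ∈ maximalIdeal (MvPowerSeries (Fin 3) k)) :
    IsLocalHom (φ : MvPowerSeries (Fin 3) k →+* MvPowerSeries (Fin 3) k) := by
  refine ⟨fun a ha => ?_⟩
  by_contra hna
  have ha𝔪 : a ∈ Ideal.span ({u 0, u 1, u 2} : Set (MvPowerSeries (Fin 3) k)) := by
    rw [hu]; exact (mem_maximalIdeal _).mpr hna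
  have hφa : (φ : MvPowerSeries (Fin 3) k →+* MvPowerSeries (Fin 3) k) a ∈
      maximalIdeal (MvPowerSeries (Fin 3) k) := by
    have := Ideal.mem_map_of_mem (φ : MvPowerSeries (Fin 3) k →+* MvPowerSeries (Fin 3) k) ha𝔪
    rw [Ideal.map_span] at this
    refine (Ideal.span_le.mpr ?_) this
    rintro _ ⟨v, hv, rfl⟩
    simp only [Set.mem_insert_iff, Set.mem_singleton_iff] at hv
    rcases hv with rfl | rfl | rfl
    · exact hφu 0
    · exact hφu 1
    · exact hφu 2
  exact (mem_maximalIdeal _).mp hφa ha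

/-! ## The Tr1 / Tr2 alternative for a point step -/

/-- **Cutkosky 2009, proof of Thm. 10.18: «`R_{n+1}` must be a Tr1 or Tr2 transformation of `R_n` by
Lemma 5.1, since `V(z_n)` is an approximate manifold of `I_n`», PROVED** in the frame of
`CutkoskySurfaceOmegaSequence.lean`: for a point step `IsPointStep I I' φ r` (`r ≥ 1`) between ideals
of order exactly `r` and regular parameters `c = (z, x, y)` with `I ⊆ (z^r) + 𝔪^{r+1}`, either
(Tr1) `∃ η` (zero or a unit) and regular parameters `c'` of the target with `c'_1 = φ(x)`,
`φ(z) = φ(x) c'_0`, `φ(y − η x) = φ(x) c'_2`, `I R' ⊆ (φ(x)^r)`, `I' = (I R' : φ(x)^r)`; or (Tr2)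
regular parameters `c'` with `c'_2 = φ(y)`, `φ(z) = φ(y) c'_0`, `φ(x) = φ(y) c'_1`,
`I R' ⊆ (φ(y)^r)`, `I' = (I R' : φ(y)^r)`.
[cite: Cutkosky2009, proof of Thm. 10.18, p. 37 l. 13–17; Def. 10.10 p. 31 l. 36–48] -/
theorem exists_goodChart_of_isPointStep {r : ℕ} (hr : 1 ≤ r)
    {I I' : Ideal (MvPowerSeries (Fin 3) k)}
    {φ : MvPowerSeries (Fin 3) k →ₐ[k] MvPowerSeries (Fin 3) k}
    (hst : IsPointStep I I' φ r) (hI : HasOrder I r) (hI' : HasOrder I' r)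
    {c : Fin 3 → MvPowerSeries (Fin 3) k} (hc : IsParams c)
    (hIz : I ≤ Ideal.span {c 0 ^ r} ⊔ maximalIdeal (MvPowerSeries (Fin 3) k) ^ (r + 1)) :
    (∃ η : MvPowerSeries (Fin 3) k, (η = 0 ∨ IsUnit η) ∧ ∃ c' : Fin 3 → MvPowerSeries (Fin 3) k,
        IsParams c' ∧ c' 1 = φ (c 1) ∧ φ (c 0) = φ (c 1) * c' 0 ∧
        φ (c 2 - η * c 1) = φ (c 1) * c' 2 ∧
        I.map φ ≤ Ideal.span {φ (c 1) ^ r} ∧ I' = (I.map φ).colon (Ideal.span {φ (c 1) ^ r})) ∨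
    (∃ c' : Fin 3 → MvPowerSeries (Fin 3) k,
        IsParams c' ∧ c' 2 = φ (c 2) ∧ φ (c 0) = φ (c 2) * c' 0 ∧ φ (c 1) = φ (c 2) * c' 1 ∧
        I.map φ ≤ Ideal.span {φ (c 2) ^ r} ∧ I' = (I.map φ).colon (Ideal.span {φ (c 2) ^ r})) := by
  classical
  obtain ⟨u, u', hu, hu', h0, h1, h2, hmap, hI'def⟩ := hst
  have hu'i : ∀ i, u' i ∈ maximalIdeal (MvPowerSeries (Fin 3) k) := fun i => by
    rw [← show Ideal.span {u' 0, u' 1, u' 2} = _ from hu']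
    exact Ideal.subset_span (by fin_cases i <;> simp)
  haveI : IsLocalHom (φ : MvPowerSeries (Fin 3) k →+* MvPowerSeries (Fin 3) k) := by
    refine isLocalHom_of_isPointStepData hu fun i => ?_
    fin_cases i
    · show φ (u 0) ∈ _; rw [h0]; exact hu'i 0
    · show φ (u 1) ∈ _; rw [h1]; exact Ideal.mul_mem_left _ _ (hu'i 1)
    · show φ (u 2) ∈ _; rw [h2]; exact Ideal.mul_mem_left _ _ (hu'i 2)
  have hψ := residueField_map_surjective φ
  haveI : IsRegularLocalRing (MvPowerSeries (Fin 3) k) := isRegularLocalRing_mvPowerSeries k (Fin 3)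
  have hdim : ringKrullDim (MvPowerSeries (Fin 3) k) = 3 := by
    rw [ringKrullDim_mvPowerSeries, Nat.card_eq_fintype_card, Fintype.card_fin]; rfl
  have hc0 : c 0 ∈ maximalIdeal (MvPowerSeries (Fin 3) k) := by
    rw [← show Ideal.span {c 0, c 1, c 2} = _ from hc]; exact Ideal.subset_span (by simp)
  -- Lemma 5.1 (2): the centre lies on the strict transform of `V(z)`
  have hz : c 0 ∈ Ideal.span {u 1, u 2} ⊔ maximalIdeal (MvPowerSeries (Fin 3) k) ^ 2 :=
    Cutkosky2009_L5_1_pointHyperplane hr hI ⟨hu, hu', h0, h1, h2⟩ ⟨hmap, hI'def⟩ hI' hc0 hIz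
  -- change of presentation
  have key := exists_pointChart_presentation (φ : MvPowerSeries (Fin 3) k →+* MvPowerSeries (Fin 3) k)
    hc hdim hu hu' h0 h1 h2 hψ hz
  -- transport of the exceptional ideal
  have hexc : ∀ {x : MvPowerSeries (Fin 3) k}, Ideal.span {x} = Ideal.span {u' 0} →
      Ideal.span {x ^ r} = Ideal.span {u' 0 ^ r} := fun {x} hx => by
    rw [← Ideal.span_singleton_pow, ← Ideal.span_singleton_pow, hx]
  rcases key with ⟨η, hη, c', hc', hspan, h1', h0', h2'⟩ | ⟨c', hc', hspan, h2', h0', h1'⟩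
  · have h1'' : c' 1 = φ (c 1) := h1'
    have hx : Ideal.span {φ (c 1) ^ r} = Ideal.span {u' 0 ^ r} := hexc (by rw [← h1'', hspan])
    refine Or.inl ⟨η, hη, c', hc', h1'', by simpa using h0', by simpa using h2', ?_, ?_⟩
    · rw [hx]; exact hmap
    · rw [hx]; exact hI'def
  · have h2'' : c' 2 = φ (c 2) := h2'
    have hx : Ideal.span {φ (c 2) ^ r} = Ideal.span {u' 0 ^ r} := hexc (by rw [← h2'', hspan])
    refine Or.inr ⟨c', hc', h2'', by simpa using h0', by simpa using h1', ?_, ?_⟩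
    · rw [hx]; exact hmap
    · rw [hx]; exact hI'def

end Literature.AlgebraicGeometry.Resolution.Cutkosky2009
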